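import Literature.Algebra.Homology.FreeComplexDoubleDualBaseChange
import Literature.Algebra.Module.TwoTermComplexReprModuleResidueField
import Mathlib.RingTheory.LocalRing.Module
import HarnessLib

/-!
# The representing module of `R ⊗_A K•` over a local `A`-algebra `R` is the residue field, from tests on the `A`-side kernels
# `ker(d ⊗_A B)` ([MumfordAV1970] §13 pp. 127–129; [EGAIII2] (7.7.6))

Layer `Literature/Algebra/Homology`, namespace `Literature.Algebra.Homology`.  THEOREMS ONLY (no definition, no named fact, no instance, no notation,
no `sorry`), over ★ `BaseChangeComplex` (`baseChangeComplex R K• = R ⊗_A K•`), ★ `FreeComplexDoubleDualBaseChange` §4 ([EGAIII2] (7.7.6): the module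
`Q = Dual K⁰ ⧸ im d^∨` represents `M ↦ ker(M ⊗ K⁰ → M ⊗ K¹)`, naturally in `M`) and ★ `Algebra/Module/TwoTermComplexReprModuleResidueField` (thickening tests
force `Q ≅ k`).  Cell `hodgecm-mathlib` (D-0151), brick (c-geom-2b-alg) of the «H1-DIM-ANY-CHAR cut» (B-p04 memo v3 §2): the ALGEBRAIC half of the chain
`Hom_R(Q_R, B) ≅ ker(B ⊗_R (R ⊗_A K⁰) → …) ≅ ker(B ⊗_A K⁰ → B ⊗_A K¹)` (`B` an `R`-algebra, e.g. `R⁄J`, `k`), so that the two geometric inputs — (h1′) «the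
fibre kernel `ker(d ⊗_A k)` is a line» (`= Γ(A, 𝒪_A) = k` through ★ `kernelReprEquiv`) and (h2′) «no thickening `R⁄J` (`𝔪² ≤ J ≠ 𝔪`) has its kernel mapping ONTO the
fibre kernel» (★ `PoincarePointRestrictingToUnit`) — yield the inputs `(ε, hε, h₁)` of ★ `finrank_HOne_baseChangeComplex_residueField_eq_finrank_cotangentSpace` for
`K•_R = R ⊗_A K•`.

Setting: `A → R` commutative, `R` LOCAL with residue field `k` and `𝔪` finitely generated, `K•` a cochain complex of `A`-modules with `K⁰, K¹` finitely generated
projective (a Grothendieck complex over an affine base), `d = d⁰ : K⁰ → K¹`, `K•_R := baseChangeComplex R K•` (terms `R ⊗_A Kⁱ`, free over the local `R`).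

* §1 `cancelBaseChange_lTensor_baseChange`, `cancelBaseChange_rTensor` — Mathlib's `B ⊗_R (R ⊗_A N) ≅ B ⊗_A N` intertwines `1_B ⊗ (d ⊗ R)` with `d ⊗ B` and is
  natural along `R`-linear maps `B → B′`; `mem_ker_baseChange_iff_cancelBaseChange` — kernel membership transports.
* §2 **`exists_residueField_surjective_exact_lcomp_baseChange_of_ker_tests`** — under (h1′) `finrank_k ker(d ⊗_A k) = 1` and (h2′) «for every ideal `J` with
  `𝔪·𝔪 ≤ J ≠ 𝔪` and `R`-linear `p : R⁄J → k` over the residue map, NOT every element of `ker(d ⊗_A k)` lifts to `ker(d ⊗_A R⁄J)` along `p ⊗ 1`», there is a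
  surjection `ε : Dual_R(R ⊗_A K⁰) ↠ k` with `Exact (lcomp R R (d ⊗ R)) ε`.

HC_CM is proved only modulo the 7 printed citations until rung 0 closes; nothing here bears on a summit statement (count-neutral capital).

## References
* [EGAIII2] A. Grothendieck, *EGA III₂* (1963), (7.7.6).
* [MumfordAV1970] D. Mumford, *Abelian Varieties* (1970), §13, proof of the Theorem (pp. 127–129); §5 Lemma 1 (p. 47).
* [AtiyahMacdonald1969] M. F. Atiyah, I. G. Macdonald, *Introduction to Commutative Algebra* (1969), Prop. 2.14 and Ex. 2.20 (p. 31) (base change).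
-/

set_option autoImplicit false

universe u

open IsLocalRing TensorProduct Module

noncomputable section

namespace Literature.Algebra.Homology

/-! ## §1 `B ⊗_R (R ⊗_A N) ≅ B ⊗_A N` versus `d ⊗ R`, and naturality along `B → B′` -/

section Cancel

variable {A R : Type u} [CommRing A] [CommRing R] [Algebra A R]
  {N N' : Type u} [AddCommGroup N] [Module A N] [AddCommGroup N'] [Module A N'] (d : N →ₗ[A] N')
  (B : Type u) [CommRing B] [Algebra R B] [Algebra A B] [IsScalarTower A R B]

/-- **`cancelBaseChange` intertwines `1_B ⊗_R (d ⊗ R)` with `d ⊗ B`**: `cancel ((1 ⊗ (d ⊗ R)) z) = (d ⊗ B) (cancel z)` for `z ∈ B ⊗_R (R ⊗_A N)` (on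
`b ⊗ (r ⊗ x)` both sides are `(r • b) ⊗ d x`). [cite: AtiyahMacdonald1969, Prop. 2.14 and Ex. 2.20 (p. 31)] -/
theorem cancelBaseChange_lTensor_baseChange (z : B ⊗[R] (R ⊗[A] N)) :
    AlgebraTensorModule.cancelBaseChange A R B B N' ((d.baseChange R).lTensor B z) =
      d.baseChange B (AlgebraTensorModule.cancelBaseChange A R B B N z) := by
  induction z using TensorProduct.induction_on with
  | zero => simp only [map_zero]
  | add x y hx hy => simp only [map_add, hx, hy]
  | tmul b w =>
    induction w using TensorProduct.induction_on with
    | zero => simp only [tmul_zero, map_zero]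
    | add x y hx hy => simp only [tmul_add, map_add, hx, hy]
    | tmul r x =>
      rw [LinearMap.lTensor_tmul, LinearMap.baseChange_tmul, AlgebraTensorModule.cancelBaseChange_tmul,
        AlgebraTensorModule.cancelBaseChange_tmul, LinearMap.baseChange_tmul]

/-- **Kernel membership transports along `cancelBaseChange`**: `z ∈ ker(1_B ⊗ (d ⊗ R)) ↔ cancel z ∈ ker(d ⊗ B)`.
[cite: AtiyahMacdonald1969, Prop. 2.14 and Ex. 2.20 (p. 31)] -/
theorem mem_ker_lTensor_baseChange_iff (z : B ⊗[R] (R ⊗[A] N)) :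
    (d.baseChange R).lTensor B z = 0 ↔ d.baseChange B (AlgebraTensorModule.cancelBaseChange A R B B N z) = 0 := by
  rw [← cancelBaseChange_lTensor_baseChange d B z]
  exact (LinearEquiv.map_eq_zero_iff _).symm

variable {B} (B' : Type u) [CommRing B'] [Algebra R B'] [Algebra A B'] [IsScalarTower A R B'] (p : B →ₗ[R] B')

/-- **Naturality of `cancelBaseChange` along an `R`-linear `p : B → B′`**: `cancel ((p ⊗ 1) z) = (p ⊗_A 1) (cancel z)` (on `b ⊗ (r ⊗ x)` both sides are
`(r • p b) ⊗ x`). [cite: AtiyahMacdonald1969, Prop. 2.14 and Ex. 2.20 (p. 31)] -/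
theorem cancelBaseChange_rTensor (z : B ⊗[R] (R ⊗[A] N)) :
    AlgebraTensorModule.cancelBaseChange A R B' B' N (p.rTensor (R ⊗[A] N) z) =
      (p.restrictScalars A).rTensor N (AlgebraTensorModule.cancelBaseChange A R B B N z) := by
  induction z using TensorProduct.induction_on with
  | zero => simp only [map_zero]
  | add x y hx hy => simp only [map_add, hx, hy]
  | tmul b w =>
    induction w using TensorProduct.induction_on with
    | zero => simp only [tmul_zero, map_zero]
    | add x y hx hy => simp only [tmul_add, map_add, hx, hy]
    | tmul r x =>
      rw [LinearMap.rTensor_tmul, AlgebraTensorModule.cancelBaseChange_tmul, AlgebraTensorModule.cancelBaseChange_tmul,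
        LinearMap.rTensor_tmul, LinearMap.restrictScalars_apply, map_smul]

end Cancel

/-! ## §2 The representing module of `R ⊗_A K•` is `k`, from the `A`-side kernel tests -/

section Main

variable {A R : Type u} [CommRing A] [CommRing R] [Algebra A R] [IsLocalRing R] (K : CochainComplex (ModuleCat.{u} A) ℤ)

/-- In an `R`-module `k ⊗_R X` (`k` the residue field) the `R`-action factors through `k`: `r • z = residue r • z`. [folklore]
[cite: AtiyahMacdonald1969, Prop. 2.14 and Ex. 2.20 (p. 31)] -/
theorem smul_residueField_tensor_eq {X : Type u} [AddCommGroup X] [Module R X] (r : R) (z : ResidueField R ⊗[R] X) :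
    r • z = IsLocalRing.residue R r • z := by
  rw [← algebraMap_smul (ResidueField R) r z]
  rfl

/-- **THE REPRESENTING MODULE OF `R ⊗_A K•` IS THE RESIDUE FIELD, FROM `A`-SIDE KERNEL TESTS** ([MumfordAV1970] §13 pp. 127–129; [EGAIII2] (7.7.6)).
`A → R` with `R` local, `𝔪` finitely generated, `K⁰, K¹` finite projective over `A`, `d = d⁰`.  Assume (h1′) `finrank_k ker(d ⊗_A k) = 1` and (h2′) for every ideal
`J` with `𝔪·𝔪 ≤ J`, `J ≠ 𝔪`, and every `R`-linear `p : R⁄J → k` over the residue map, NOT every `y ∈ ker(d ⊗_A k)` is `(p ⊗ 1) x` for some `x ∈ ker(d ⊗_A R⁄J)`.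
Then there is a SURJECTION `ε : Dual_R(R ⊗_A K⁰) ↠ k` with `Exact (lcomp R R (d ⊗ R)) ε` — the inputs `(ε, hε, h₁)` of ★
`finrank_HOne_baseChangeComplex_residueField_eq_finrank_cotangentSpace` for `K•_R = baseChangeComplex R K•`.  (★ EGA (7.7.6) `Φ_M : Hom_R(Q_R, M) ≅ ker(M ⊗_R d_R)`
naturally in `M`, §1 `cancelBaseChange`, and ★ `nonempty_linearEquiv_residueField_of_hom_thickening_tests`.)
[cite: MumfordAV1970, §13 (proof of the Theorem, pp. 127–129)] [cite: EGAIII2, (7.7.6)] -/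
theorem exists_residueField_surjective_exact_lcomp_baseChange_of_ker_tests (hfg : (maximalIdeal R).FG)
    (h0 : Module.Finite A (K.X 0) ∧ Module.Projective A (K.X 0)) (h1P : Module.Finite A (K.X 1) ∧ Module.Projective A (K.X 1))
    (h1 : Module.finrank (ResidueField R) ↥(LinearMap.ker ((K.d 0 1).hom.baseChange (ResidueField R))) = 1)
    (h2 : ∀ (J : Ideal R) (p : R ⧸ J →ₗ[R] ResidueField R), maximalIdeal R • maximalIdeal R ≤ J → J ≠ maximalIdeal R →
      (∀ r : R, p (Submodule.Quotient.mk r) = IsLocalRing.residue R r) →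
      ¬ ∀ y : ResidueField R ⊗[A] K.X 0, (K.d 0 1).hom.baseChange (ResidueField R) y = 0 →
        ∃ x : (R ⧸ J) ⊗[A] K.X 0, (K.d 0 1).hom.baseChange (R ⧸ J) x = 0 ∧ (p.restrictScalars A).rTensor (K.X 0) x = y) :
    ∃ ε : ((baseChangeComplex R K).X 0 →ₗ[R] R) →ₗ[R] ResidueField R,
      Function.Surjective ε ∧ Function.Exact (LinearMap.lcomp R R ((baseChangeComplex R K).d 0 1).hom) ε := by
  classical
  set k := ResidueField R with hk
  set KR := baseChangeComplex R K with hKR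
  -- the terms of `K•_R` are finite free over the local `R`
  have hfp : ∀ n ∈ ({0, 1} : Set ℤ), Module.Finite R (KR.X n) ∧ Module.Projective R (KR.X n) := by
    intro n hn
    rcases hn with rfl | rfl
    · haveI := h0.1; haveI := h0.2
      exact ⟨inferInstanceAs (Module.Finite R (R ⊗[A] K.X 0)), inferInstanceAs (Module.Projective R (R ⊗[A] K.X 0))⟩
    · haveI := h1P.1; haveI := h1P.2
      exact ⟨inferInstanceAs (Module.Finite R (R ⊗[A] K.X 1)), inferInstanceAs (Module.Projective R (R ⊗[A] K.X 1))⟩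
  haveI : Module.Finite R (KR.X 0) := (hfp 0 (by simp)).1
  haveI : Module.Finite R (KR.X 1) := (hfp 1 (by simp)).1
  haveI : Module.Free R (KR.X 0) := by
    haveI := (hfp 0 (by simp)).2
    haveI : Module.Flat R (KR.X 0) := Module.Flat.of_projective
    exact Module.free_of_flat_of_isLocalRing
  haveI : Module.Free R (KR.X 1) := by
    haveI := (hfp 1 (by simp)).2
    haveI : Module.Flat R (KR.X 1) := Module.Flat.of_projective
    exact Module.free_of_flat_of_isLocalRing
  -- the differential of `K•_R` is `d ⊗ R`
  have hdR : (KR.d 0 1).hom = (K.d 0 1).hom.baseChange R := baseChangeComplex_d_hom R K 0 1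
  -- EGA (7.7.6): `Φ_M : Hom_R(Q, M) ≅ ker(M ⊗_R d_R)`, contraction formula and naturality
  obtain ⟨Φ, -, hΦn⟩ := exists_homCokerDual_linearEquiv_HZero_natural KR
  set Q := ((KR.X 0 →ₗ[R] R) ⧸ LinearMap.range (LinearMap.lcomp R R (KR.d 0 1).hom)) with hQ
  haveI : Module.Finite R Q := inferInstance
  -- kernel transport `z ↦ cancel z` for an `R`-algebra `B` over `A`
  have hker : ∀ (B : Type u) [CommRing B] [Algebra R B] [Algebra A B] [IsScalarTower A R B] (z : B ⊗[R] KR.X 0),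
      z ∈ LinearMap.ker ((KR.d 0 1).hom.lTensor B) ↔
        (K.d 0 1).hom.baseChange B (AlgebraTensorModule.cancelBaseChange A R B B (K.X 0) z) = 0 := by
    intro B _ _ _ _ z
    rw [LinearMap.mem_ker, hdR]
    exact mem_ker_lTensor_baseChange_iff (K.d 0 1).hom B z
  -- (h1) `Hom_R(Q, k)` is a line: it is `k`-isomorphic to `ker(d ⊗_A k)`
  have hH1 : Module.finrank k (Q →ₗ[R] k) = 1 := by
    let Mk : ModuleCat.{u} R := ModuleCat.of R k
    let c := AlgebraTensorModule.cancelBaseChange A R k k (K.X 0)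
    -- the `k`-linear map `φ ↦ cancel (Φ_k φ)` into `ker(d ⊗_A k)`
    -- underlying element of `Φ_k φ` in `k ⊗_R (R ⊗_A K⁰)`
    let v : (Q →ₗ[R] k) → k ⊗[R] (R ⊗[A] K.X 0) := fun φ => (Φ Mk φ).1
    have hv_add : ∀ φ ψ, v (φ + ψ) = v φ + v ψ := fun φ ψ => by
      change (Φ Mk (φ + ψ)).1 = (Φ Mk φ).1 + (Φ Mk ψ).1
      rw [map_add]
      rfl
    have hv_smul : ∀ (r : R) φ, v (r • φ) = r • v φ := fun r φ => by
      change (Φ Mk (r • φ)).1 = r • (Φ Mk φ).1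
      rw [map_smul]
      rfl
    have hv_mem : ∀ φ, (K.d 0 1).hom.baseChange k (c (v φ)) = 0 := fun φ => (hker k _).1 (Φ Mk φ).2
    let F : (Q →ₗ[R] k) →ₗ[k] ↥(LinearMap.ker ((K.d 0 1).hom.baseChange k)) :=
      { toFun := fun φ => ⟨c (v φ), (LinearMap.mem_ker).2 (hv_mem φ)⟩
        map_add' := fun φ ψ => by
          ext
          change c (v (φ + ψ)) = c (v φ) + c (v ψ)
          rw [hv_add, map_add]
        map_smul' := fun a φ => by
          ext
          change c (v (a • φ)) = a • c (v φ)
          obtain ⟨r, rfl⟩ := IsLocalRing.residue_surjective a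
          rw [← Literature.Algebra.Module.smul_hom_residueField_eq, hv_smul, smul_residueField_tensor_eq, map_smul] }
    have hFinj : Function.Injective F := by
      intro φ ψ h
      have h' : c (v φ) = c (v ψ) := congrArg Subtype.val h
      exact (Φ Mk).injective (Subtype.ext (c.injective h'))
    have hFsurj : Function.Surjective F := by
      rintro ⟨y, hy⟩
      have hz : c.symm y ∈ LinearMap.ker ((KR.d 0 1).hom.lTensor Mk) := by
        refine (hker k (c.symm y)).2 ?_
        rw [LinearEquiv.apply_symm_apply]
        exact (LinearMap.mem_ker).1 hy
      refine ⟨(Φ Mk).symm ⟨c.symm y, hz⟩, Subtype.ext ?_⟩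
      change c ((Φ Mk ((Φ Mk).symm ⟨c.symm y, hz⟩)).1) = y
      rw [LinearEquiv.apply_symm_apply]
      exact c.apply_symm_apply y
    rw [← h1]
    exact (LinearEquiv.ofBijective F ⟨hFinj, hFsurj⟩).finrank_eq
  -- (h2) no thickening test is surjective on `Hom_R(Q, -)`
  have hH2 : ∀ (J : Ideal R) (p : R ⧸ J →ₗ[R] k), maximalIdeal R • maximalIdeal R ≤ J → J ≠ maximalIdeal R →
      (∀ r : R, p (Submodule.Quotient.mk r) = IsLocalRing.residue R r) →
      ¬ Function.Surjective (fun φ : Q →ₗ[R] R ⧸ J => p.comp φ) := by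
    intro J p hmm hne hp hsurj
    refine h2 J p hmm hne hp fun y hy => ?_
    let Mk : ModuleCat.{u} R := ModuleCat.of R k
    let MJ : ModuleCat.{u} R := ModuleCat.of R (R ⧸ J)
    let ck := AlgebraTensorModule.cancelBaseChange A R k k (K.X 0)
    let cJ := AlgebraTensorModule.cancelBaseChange A R (R ⧸ J) (R ⧸ J) (K.X 0)
    -- `y` as an element of `ker(k ⊗_R d_R)`, and its preimage `φ_y ∈ Hom_R(Q, k)`
    have hz : ck.symm y ∈ LinearMap.ker ((KR.d 0 1).hom.lTensor Mk) := by
      refine (hker k (ck.symm y)).2 ?_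
      rw [LinearEquiv.apply_symm_apply]
      exact hy
    let φy : Q →ₗ[R] k := (Φ Mk).symm ⟨ck.symm y, hz⟩
    obtain ⟨φ', hφ'⟩ := hsurj φy
    -- `x := cancel (Φ_{R⁄J} φ')`
    let x' : (R ⧸ J) ⊗[R] (R ⊗[A] K.X 0) := (Φ MJ φ').1
    refine ⟨cJ x', (hker (R ⧸ J) x').1 (Φ MJ φ').2, ?_⟩
    -- naturality: `(p ⊗ 1) (cancel (Φ φ')) = cancel ((p ⊗ 1) (Φ φ')) = cancel (Φ (p ∘ φ')) = cancel (Φ φ_y) = y`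
    rw [← cancelBaseChange_rTensor (N := K.X 0) k p x']
    have hnat : (Φ Mk (p ∘ₗ φ')).1 = p.rTensor (KR.X 0) x' := hΦn MJ Mk p φ'
    have hφ'' : p ∘ₗ φ' = φy := hφ'
    have hx' : p.rTensor (R ⊗[A] K.X 0) x' = ck.symm y := by
      change p.rTensor (KR.X 0) x' = ck.symm y
      rw [← hnat, hφ'']
      change (Φ Mk ((Φ Mk).symm ⟨ck.symm y, hz⟩)).1 = ck.symm y
      rw [LinearEquiv.apply_symm_apply]
    rw [hx']
    exact ck.apply_symm_apply y
  -- (c-alg″): `Q ≅ k`, and `ε := e ∘ mkQ`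
  obtain ⟨e⟩ := Literature.Algebra.Module.nonempty_linearEquiv_residueField_of_hom_thickening_tests hfg hH1 hH2
  refine ⟨e.toLinearMap.comp (LinearMap.range (LinearMap.lcomp R R (KR.d 0 1).hom)).mkQ, ?_, ?_⟩
  · exact e.surjective.comp (Submodule.mkQ_surjective _)
  · intro φ
    constructor
    · intro hφ
      have hφ' : (LinearMap.range (LinearMap.lcomp R R (KR.d 0 1).hom)).mkQ φ = 0 := e.injective (by rw [map_zero]; exact hφ)
      rwa [Submodule.mkQ_apply, Submodule.Quotient.mk_eq_zero, LinearMap.mem_range] at hφ'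
    · rintro ⟨ψ, rfl⟩
      change e ((LinearMap.range (LinearMap.lcomp R R (KR.d 0 1).hom)).mkQ (LinearMap.lcomp R R (KR.d 0 1).hom ψ)) = 0
      rw [Submodule.mkQ_apply, (Submodule.Quotient.mk_eq_zero _).2 (LinearMap.mem_range_self _ ψ), map_zero]

end Main

end Literature.Algebra.Homology

end
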